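import Summits.ABC.ABC.Theorems.IUTThetaPilotABCExpThreeDegOnePrelims
import Literature.IUT.LogVolume.Corollary22PartIIICore
import Literature.IUT.LogVolume.Corollary22PartIIPointwise
import Literature.IUT.LogVolume.Corollary22PartIIUpTo
import HarnessLib

/-!
# R-H ROUND 2, Q1 (cell/packet-strata rows 3/4/5; seat abc-iut-rh2-xi-1): the MULTIPLICATIVE abc-tolerance of the off-Σ remainder, IV —
# THE EXPONENT CLASS, part 1: [IUTchIV] Cor. 2.2 (ii) re-run at the Frey–Legendre point with the DILATED display `1/6 ↦ μ/6` ⟹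
# `c < C_ε·rad(abc)^{3/μ+ε}` for EVERY abc triple (`0 < μ ≤ 1`; degree one, reading (U), `K_V`-free)

PROOF-ONLY sequel (no `def`, no new `Prop`, no instance, no notation; nothing re-typed) of this seat's `RHOffSigmaToleranceMult.lean` (p476254:
`display_dilated_of_squeezeIII`, the exponent-loss display SHAPE `1/6 ↦ (1−κ)/6`, whose docstring records «its Cor. 2.2 (ii) consequence, an
`ABCExponentBound`-type statement, is not typed») and of abc-iut-S6's `K_V`-free degree-one line `IUTThetaPilotABCExpThreeDegOne(Prelims).lean`
(`ThetaPartIIDegOne.arith_core`, `condP6_ratPoint_triple`, `sq_le_of_le_add_mul_log`, `log_le_three_mul_of_thm110LegendreUpTo_one`: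
`Thm110LegendreUpTo 1 ⟹ log c ≤ 3(1+ε)·log rad + C_ε`). Same question in abc-iut-rh2-T-1's `Conditional/AbcOfSigmaMassDisplay.lean` (p477154,
regime (R2) `dilatedDisplay_of_offSigmaTolerance`: «an ABC-with-exponent endpoint is NOT typed, [GenEll] fixed-exponent chain absent»). Rung
LADDER-ABC:A2.RESCUE.H, R-H round 2 (director-abc g3 tranche 1 (7); ROUND2/READING.md v1.2 §Q2 «EXPONENT» and §ANSWER: «otherwise an abc-type
inequality with exponent factor `1/μ_r`» — so far a DISPLAY-level sentence). TAKES NO SIDE on [IUTchIII] Cor. 3.12 or on any author; typed ≠ proved.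

THE QUESTION THIS FILE SETTLES. The READING of record prices a relative off-Σ shortfall `κ = 1 − μ_r` (licensed share `μ_r` of the datum's
`j²`-mass `M = T.gap`) as «exponent factor `1/μ_r`», but in the kernel that sentence stopped at [IUTchIV] Thm. 1.10's DISPLAY
(`(1−κ)/6·log(q) ≤ …`): the tree's [GenEll] Thm. 2.1 chain carries the printed `1+ε` for EVERY `ε > 0` and cannot transport a fixed factor.
**Which abc-type inequality does a display dilated by a fixed `μ ∈ (0,1]` give, as a kernel theorem?** ANSWER (degree one, reading (U),
`K_V`-free): `log c ≤ (3/μ)·(1+ε)·log rad(abc) + C_ε` for every `0 < ε ≤ 1` and EVERY abc triple, i.e. `c < C_ε·rad(abc)^{3/μ+ε}` — Cor. 2.2 (ii)'s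
proof (pp. 43–48) re-run at `λ = a/c` with the dilated display, the dilation passing straight through print's arithmetic (`arith_core` VERBATIM,
applied to `μ·X`, `μ·log(q^{∤2})`, `μ·log(q)`, `μ·h`; the only changed constant is the `ε_E`-threshold, taken at `ε·μ/6`). At `μ = 1` this is
abc-iut-S6's `3+ε`; the passage `3 ↦ 1` is Cor. 2.2 (ii) in ALL degrees + [GenEll] Thm. 2.1 (not typed with a factor, said so).
* `log_le_of_dilatedDisplay_degOne` — the DILATED display `(1/6)·(μ·log(q^{∤{2,l}})) ≤ (1 + 20·d_mod/l)·(log-diff + log-cond) + 20·(d*·l + η_prm)`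
  at every admissible RATIONAL `(P, l)` (hypothesis SHAPE spelled out — no new `Prop`; at `μ = 1` it is `Cor22.Thm110LegendreUpTo 1`) ⟹
  `log c ≤ (3/μ)(1+ε)·log rad + C_ε`; **`abc_exp_of_dilatedDisplay_degOne`** — `c < C_ε·rad^{3/μ+ε}`.
* The sequel `RHOffSigmaToleranceExponentDoor.lean` feeds the hypothesis from this seat's door at degree one (CONE-FREE there: the hull estimate
  at `d_mod = 1` is a theorem): [NUMΣ-upTo]₁ + `OffSigmaTolerance κ Tol(P,l) T B` (`0 ≤ κ < 1`) at the Szpiro-bad rational data ⟹ exponent `3/(1−κ)+ε`.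
What is NOT here: the `1+ε ↦ (1+ε)/μ` endpoint for `ABC` itself (needs Cor. 2.2 (ii) at `d_mod > 1`, hence the cone / Step-(v) residue, and a
[GenEll] Thm. 2.1 with a factor). HONEST SCOPE: pure real arithmetic over an assumption-labelled display; CONDITIONAL; nothing here asserts that
abc (with any exponent) is proved or refuted, or that Thm. 1.10's display (dilated or not) holds at any datum; no side taken; typed ≠ proved;
instantiated ≠ endorsed.
[cite: Mochizuki2012, IUTchIV Thm. 1.10 pp. 22–31; Cor. 2.2 (ii) statement pp. 41–43, proof pp. 43–48; Cor. 2.3 pp. 54–55]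
[claim: Mochizuki2012, status: disputed]
Axioms: standard.
-/

noncomputable section

namespace Summit.ABC.IUTFork.Repair.RH.OffSigma

open Literature.IUT.LogVolume Literature.IUT.LogVolume.Cor22
open Literature.NumberTheory.DiophantineGeometry Literature.NumberTheory.DiophantineGeometry.GenEll
open Summit.ABC.ABC.Theorems Summit.ABC.ABC.Theorems.ThetaPartIIDegOne
open NumberField IsDedekindDomain Real

/-! ## §1 [IUTchIV] Cor. 2.2 (ii) at the Frey–Legendre point with the DILATED display: exponent `3/μ` -/

/-- **The DILATED display at the rational points implies `log c ≤ (3/μ)·(1+ε)·log rad(abc) + C_ε` for every `0 < ε ≤ 1` and EVERY abc triple**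
(`0 < μ ≤ 1`): [IUTchIV] Cor. 2.2 (ii)'s proof (pp. 43–48) run at `λ = a/c` exactly as in abc-iut-S6's `log_le_three_mul_of_thm110LegendreUpTo_one`
(no `K_V`: `2·log (abc)_{odd} ≤ log(q^{∤2})`, `c ≤ 2(abc)_{odd}`, the prime `l` of (P1)–(P3), (P5) by `sq_le_of_le_add_mul_log`, (P6) by
`condP6_ratPoint_triple`), with the display's `1/6` replaced by `μ/6`: print's arithmetic `arith_core` is applied to `μ·X`, `μ·log(q)`, `μ·log(q^{∤2})`,
`μ·h` (the `ε_E`-threshold taken at `ε·μ/6`), giving `μ·X ≤ 3(1+ε)·R + (5ε/6 + 120η)`. CONDITIONAL on `hdisp` (a hypothesis SHAPE, spelled out;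
at `μ = 1` it is `Cor22.Thm110LegendreUpTo 1`); no side taken. [cite: Mochizuki2012, IUTchIV Cor. 2.2 (ii) proof pp. 43–48] [claim: Mochizuki2012, status: disputed] -/
theorem log_le_of_dilatedDisplay_degOne {μ : ℝ} (hμ0 : 0 < μ) (hμ1 : μ ≤ 1)
    (hdisp : ∀ η : ℝ, IsEtaPrm η → ∀ P : NFPoint, P ∈ UP → P.degree ≤ 1 → ∀ l : ℕ, l.Prime → 5 ≤ l →
      AdmitsCore P → CondP2 P l → CondP5 P l → CondP6 P l →
      1 / 6 * (μ * logQAvoid P {2, l}) ≤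
        (1 + 20 * (dmod P : ℝ) / l) * (P.logDiff + logCondAvoid P {2, l})
          + 20 * (2 ^ 12 * 3 ^ 3 * 5 * (dmod P : ℝ) * l + η))
    {ε : ℝ} (hε : 0 < ε) (hε1 : ε ≤ 1) :
    ∃ C : ℝ, ∀ a b c : ℕ, IsABCTriple a b c →
      Real.log c ≤ 3 / μ * (1 + ε) * Real.log (rad a b c) + C := by
  classical
  obtain ⟨ξ, hξ⟩ := exists_isXiPrm
  have hξ5 : 5 ≤ ξ := hξ.1
  obtain ⟨η, hη⟩ := exists_isEtaPrm
  have hη0 : 0 < η := hη.1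
  obtain ⟨G₀, hG₀⟩ := condP6_ratPoint_triple
  obtain ⟨H₃, hH₃0, hH₃⟩ := exists_threshold_sixtyDeltaSq_log_div_sqrt_le
  -- the `ε_E`-threshold is taken at `ε·μ/6` (the only place where the dilation enters the choice of constants)
  set ε₁ : ℝ := ε * μ / 6 with hε₁def
  have hε₁0 : 0 < ε₁ := by positivity
  have hε₁1 : ε₁ ≤ 1 := by
    rw [hε₁def]
    have : ε * μ ≤ 1 * 1 := mul_le_mul hε1 hμ1 hμ0.le (by norm_num)
    linarith
  obtain ⟨Hthr, hHthr⟩ : ∃ Hthr : ℝ, Hthr = H₃ * ε₁ ^ (-(3 : ℝ)) * (1 : ℝ) ^ (-(3 : ℝ)) * ((1 : ℕ) : ℝ) ^ (4 + (1 : ℝ)) :=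
    ⟨_, rfl⟩
  obtain ⟨δ, hδdef⟩ : ∃ δ : ℝ, δ = delta 1 := ⟨_, rfl⟩
  have hδv : δ = 552960 := by rw [hδdef]; unfold delta; norm_num
  have hδ2 : 2 ≤ δ := by rw [hδv]; norm_num
  -- the height threshold below which everything is absorbed into the constant
  set H₁ : ℝ := ξ ^ 2 + 50 + max G₀ 0 + max Hthr 0 + (80 / ε) ^ 2 + (91 + 6 * δ) ^ 4 with hH₁
  have hG0 : 0 ≤ max G₀ 0 := le_max_right _ _
  have hT0 : 0 ≤ max Hthr 0 := le_max_right _ _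
  have hε80 : 0 ≤ (80 / ε) ^ 2 := sq_nonneg _
  have h43 : 0 ≤ (91 + 6 * δ) ^ 4 := by positivity
  have hξ0 : 0 ≤ ξ ^ 2 := sq_nonneg _
  have hH₁0 : 0 ≤ H₁ := by rw [hH₁]; positivity
  have hlog2 : Real.log 2 ≤ 1 := by have := Real.log_two_lt_d9; linarith
  have hK0 : 0 ≤ (5 * (ε / 6) + 120 * η) / μ := by positivity
  refine ⟨H₁ / 2 + 1 + (5 * (ε / 6) + 120 * η) / μ, fun a b c ht => ?_⟩
  obtain ⟨P, hP⟩ : ∃ P : NFPoint, P = ratPoint ((a : ℚ) / c) := ⟨_, rfl⟩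
  have hmem : P ∈ UPle 1 := by rw [hP]; exact ratPoint_triple_mem ht
  have hPU : P ∈ UP := hmem.1
  have hdeg : P.degree ≤ 1 := hmem.2
  have hInU : P.InU := hPU.1
  -- the quantities of the triple
  have hcpos : 0 < c := by have := ht.2.2.1; have := ht.1; omega
  have hc0 : (0 : ℝ) < c := by exact_mod_cast hcpos
  obtain ⟨X, hX⟩ : ∃ X : ℝ, X = Real.log (ordCompl[2] (a * b * c) : ℕ) := ⟨_, rfl⟩
  obtain ⟨h, hh⟩ : ∃ h : ℝ, h = logQForall P := ⟨_, rfl⟩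
  obtain ⟨R, hR⟩ : ∃ R : ℝ, R = Real.log (rad a b c) := ⟨_, rfl⟩
  have hR0 : 0 ≤ R := by
    have : 0 < rad a b c := by rw [rad_def]; exact Nat.pos_of_ne_zero UniqueFactorizationMonoid.radical_ne_zero
    rw [hR]; exact Real.log_nonneg (by exact_mod_cast this)
  have hX2 : 2 * X ≤ logQNotTwo P := by rw [hX, hP]; exact two_mul_log_oddPart_le_logQNotTwo ht
  have hq2h : logQNotTwo P ≤ h := by rw [hh]; exact logQAvoid_anti P (Finset.empty_subset _)
  have hhht : h ≤ htInfty P := by rw [hh]; exact logQForall_le_htInfty P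
  have hht : htInfty P ≤ 6 * Real.log c + Real.log 256 := by rw [hP]; exact htInfty_ratPoint_triple_le ht
  have hc2 : (c : ℝ) ≤ 2 * (ordCompl[2] (a * b * c) : ℕ) := natCast_le_two_mul_oddPart ht
  have hodd0 : (0 : ℝ) < (ordCompl[2] (a * b * c) : ℕ) := by linarith
  have hlogc : Real.log c ≤ X + Real.log 2 := by
    rw [hX, add_comm, ← Real.log_mul (by norm_num) hodd0.ne']
    exact Real.log_le_log hc0 hc2
  have hlog256 : Real.log 256 = 8 * Real.log 2 := by
    rw [show (256 : ℝ) = 2 ^ 8 by norm_num, Real.log_pow]; norm_num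
  have hh6 : h ≤ 6 * X + 10 := by
    have := Real.log_two_lt_d9
    rw [hlog256] at hht
    linarith
  have hh0 : 0 ≤ h := by rw [hh]; exact logQAvoid_nonneg P ∅
  have hmain0 : 0 ≤ 3 / μ * (1 + ε) * R := mul_nonneg (mul_nonneg (by positivity) (by linarith)) hR0
  -- small heights: everything is in the constant
  by_cases hcase : h ≤ H₁
  · have h1 : Real.log c ≤ H₁ / 2 + 1 := by linarith
    rw [← hR]
    linarith
  rw [not_le] at hcase
  -- large heights: the argument of pp. 44–48
  obtain ⟨s, hs⟩ : ∃ s : ℝ, s = Real.sqrt h := ⟨_, rfl⟩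
  have hs2 : s ^ 2 = h := by rw [hs]; exact Real.sq_sqrt hh0
  have hs0 : 0 ≤ s := by rw [hs]; exact Real.sqrt_nonneg h
  have hξs : ξ ≤ s := by
    rw [hs]
    calc ξ = Real.sqrt (ξ ^ 2) := (Real.sqrt_sq (by linarith)).symm
      _ ≤ Real.sqrt h := Real.sqrt_le_sqrt (by linarith)
  have h5s : 5 ≤ s := le_trans hξ5 hξs
  have hspos : 0 < s := by linarith
  have h7s : 7 < s := by
    rw [hs, Real.lt_sqrt (by norm_num)]; linarith
  have h80s : 80 / ε ≤ s := by
    rw [hs]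
    calc 80 / ε = Real.sqrt ((80 / ε) ^ 2) := (Real.sqrt_sq (by positivity)).symm
      _ ≤ Real.sqrt h := Real.sqrt_le_sqrt (by linarith)
  -- the curves without core: `log(q^∀) ≤ 12`
  have hcore : AdmitsCore P := by
    by_contra hno
    have := logQForall_le_of_not_admitsCore hno
    rw [← hh] at this
    linarith
  -- the prime `l` of (P1), (P2), (P3)
  obtain ⟨l, hlp, hP1lo, hP1hi, hP2', hP3⟩ :=
    exists_prime_P1_P2_P3_point P hdeg hξ (by rw [hs, hh] at hξs; exact hξs)
  have hP1lo' : s ≤ l := by rw [hs, hh]; exact hP1lo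
  have hP1hi' : (l : ℝ) ≤ 10 * δ * s * Real.log (2 * δ * s ^ 2) := by
    rw [hs2, hδdef, hs, hh]; exact hP1hi
  have hl7 : 7 ≤ l := by
    have : (7 : ℝ) < l := lt_of_lt_of_le h7s hP1lo'
    exact_mod_cast this.le
  have hl5 : 5 ≤ l := le_trans (by norm_num) hl7
  have hl0 : (0 : ℝ) < l := by exact_mod_cast hlp.pos
  have hl1 : (1 : ℝ) ≤ l := by exact_mod_cast hlp.one_lt.le
  have hlR5 : (5 : ℝ) ≤ l := by exact_mod_cast hl5
  haveI : Fact l.Prime := ⟨hlp⟩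
  -- (P3): `log(q^{∤2}) − log(q) ≤ h^{1/2}·log l`
  have hQ1 : logQNotTwo P - logQAvoid P {2, l} ≤ s * Real.log l :=
    logQNotTwo_sub_logQAvoid_le P hlp hs0 (fun v hv hres => by
      have := hP3 v hv hres; rw [hs, hh]; exact this.le)
  have hl_le : (l : ℝ) ≤ 20 * δ ^ 2 * s ^ 4 := l_le_of_P1 h5s hδ2 hP1hi'
  -- (P5): else `h ≤ (91 + 6δ)⁴ ≤ H₁`
  have hP5 : CondP5 P l := by
    by_contra hno
    have hq0 : logQAvoid P {2, l} = 0 := logQAvoid_pair_eq_zero_of_not_condP5 hno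
    have hmain : s ^ 2 ≤ 10 + 3 * s * Real.log l := by rw [hs2]; linarith
    have hb := sq_le_of_le_add_mul_log h5s hδ2 (by norm_num : (0 : ℝ) ≤ 10) hlR5 hl_le hmain
    rw [hs2] at hb
    have e : (10 + 81 + 6 * δ : ℝ) ^ 4 = (91 + 6 * δ) ^ 4 := by norm_num
    linarith
  -- (P6): the `K_V`-free Galois-image input
  have hP6 : CondP6 P l := by
    rw [hP] at hP2' hP5 ⊢
    refine hG₀ a b c ht l hlp hl7 hP2' hP5 ?_
    have := le_max_left G₀ 0
    rw [← hP, ← hh]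
    linarith
  -- (P7) + the DILATED display: the HYPOTHESIS, with `d_mod = 1`, `log-diff = 0`
  have hdispP := hdisp η hη P hPU hdeg l hlp hl5 hcore hP2' hP5 hP6
  have hLD : P.logDiff = 0 := by rw [hP]; exact logDiff_ratPoint _
  have hLc : logCondAvoid P {2, l} ≤ R := by
    rw [hR, ← logCond_ratPoint_triple ht]
    have := logCondAvoid_le_logCond P hInU {2, l}
    rw [hP] at this ⊢
    exact this
  have hd2 : 1 / 6 * (μ * logQAvoid P {2, l}) ≤
      (1 + 20 / (l : ℝ)) * logCondAvoid P {2, l} + 20 * (552960 * l + η) := by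
    have hd := hdispP
    have e1 : ((dmod P : ℕ) : ℝ) = 1 := by rw [dmod_eq_one_of_degree_le_one hdeg]; simp
    rw [e1, hLD] at hd
    have e : (1 + 20 * (1 : ℝ) / l) * (0 + logCondAvoid P {2, l}) + 20 * (2 ^ 12 * 3 ^ 3 * 5 * (1 : ℝ) * l + η)
        = (1 + 20 / (l : ℝ)) * logCondAvoid P {2, l} + 20 * (552960 * l + η) := by ring
    rw [← e]; exact hd
  -- `20/l ≤ ε/4`
  have h20 : 20 / (l : ℝ) ≤ ε / 4 := by
    have h80l : 80 / ε ≤ l := le_trans h80s hP1lo'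
    rw [div_le_iff₀ hε] at h80l
    rw [div_le_iff₀ hl0]
    linarith
  -- error terms `∝ s·log(2δh)`
  obtain ⟨Λ, hΛ⟩ : ∃ Λ : ℝ, Λ = Real.log (2 * δ * h) := ⟨_, rfl⟩
  have hH₁50 : 50 ≤ H₁ := by rw [hH₁]; linarith
  have h2δh : 1 < 2 * δ * h := by rw [hδv]; linarith
  have hΛ0 : 0 ≤ Λ := by rw [hΛ]; exact Real.log_nonneg h2δh.le
  obtain ⟨W, hW⟩ : ∃ W : ℝ, W = s * Λ := ⟨_, rfl⟩
  have hW0 : 0 ≤ W := by rw [hW]; exact mul_nonneg hs0 hΛ0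
  -- `l ≤ 10δ·W`
  have hlW : (l : ℝ) ≤ 10 * 552960 * W := by
    calc (l : ℝ) ≤ 10 * δ * s * Real.log (2 * δ * s ^ 2) := hP1hi'
      _ = 10 * 552960 * W := by rw [hW, hΛ, ← hs2, hδv]; ring
  -- `log l ≤ 3Λ` since `l ≤ 20δ²h² ≤ (2δh)³`
  have hlogl : Real.log l ≤ 3 * Λ := by
    have hle : (l : ℝ) ≤ (2 * δ * h) ^ 3 := by
      have e1 : 20 * δ ^ 2 * s ^ 4 = 20 * δ ^ 2 * h ^ 2 := by rw [← hs2]; ring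
      rw [e1] at hl_le
      have hk : 0 ≤ δ ^ 2 * h ^ 2 * (8 * δ * h - 20) :=
        mul_nonneg (by positivity) (by rw [hδv]; linarith)
      have e2 : δ ^ 2 * h ^ 2 * (8 * δ * h - 20) = 8 * (δ ^ 3 * h ^ 3) - 20 * (δ ^ 2 * h ^ 2) := by ring
      have e3 : (2 * δ * h) ^ 3 = 8 * (δ ^ 3 * h ^ 3) := by ring
      rw [e2] at hk
      rw [e3]
      linarith
    calc Real.log l ≤ Real.log ((2 * δ * h) ^ 3) := Real.log_le_log hl0 hle
      _ = 3 * Λ := by rw [Real.log_pow, hΛ]; norm_num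
  have hT2 : s * Real.log l ≤ 3 * W := by
    calc s * Real.log l ≤ s * (3 * Λ) := mul_le_mul_of_nonneg_left hlogl hs0
      _ = 3 * W := by rw [hW]; ring
  -- the `ε_E`-type threshold at `ε₁ = εμ/6`: `(60δ)²·Λ/√h ≤ ε₁`, i.e. `3600δ²·W ≤ ε₁·h = (ε/6)·(μ·h)`
  have hHthrh : Hthr ≤ h := by
    have h1 : Hthr ≤ max Hthr 0 := le_max_left _ _
    have h2 : max Hthr 0 ≤ H₁ := by rw [hH₁]; linarith
    linarith
  have hthr : (60 * delta 1) ^ 2 * Real.log (2 * delta 1 * h) / Real.sqrt h ≤ ε₁ := by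
    refine hH₃ H₃ le_rfl 1 le_rfl 1 one_pos le_rfl ε₁ hε₁0 hε₁1 h ?_
    rw [hHthr] at hHthrh; exact hHthrh
  have hWle : 3600 * 552960 ^ 2 * W ≤ ε / 6 * (μ * h) := by
    rw [← hδdef, ← hs, ← hΛ, div_le_iff₀ hspos] at hthr
    have hm := mul_le_mul_of_nonneg_left hthr hs0
    calc 3600 * 552960 ^ 2 * W = s * ((60 * δ) ^ 2 * Λ) := by rw [hW, hδv]; ring
      _ ≤ s * (ε₁ * s) := hm
      _ = ε / 6 * (μ * h) := by rw [← hs2, hε₁def]; ring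
  -- the dilation passes through print's arithmetic: `arith_core` at `μ·X`, `μ·log(q^{∤2})`, `μ·log(q)`, `μ·h`
  have hX2' : 2 * (μ * X) ≤ μ * logQNotTwo P := by
    have hm := mul_le_mul_of_nonneg_left hX2 hμ0.le
    have e : μ * (2 * X) = 2 * (μ * X) := by ring
    linarith
  have hQ1' : μ * logQNotTwo P - μ * logQAvoid P {2, l} ≤ s * Real.log l := by
    have hsl : 0 ≤ s * Real.log l := mul_nonneg hs0 (Real.log_nonneg hl1)
    have e : μ * (logQNotTwo P - logQAvoid P {2, l}) = μ * logQNotTwo P - μ * logQAvoid P {2, l} := by ring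
    rcases le_or_gt 0 (logQNotTwo P - logQAvoid P {2, l}) with hpos | hneg
    · have hm := mul_le_mul_of_nonneg_right hμ1 hpos
      rw [e, one_mul] at hm
      linarith
    · have hm := mul_le_mul_of_nonneg_left hneg.le hμ0.le
      rw [e, mul_zero] at hm
      linarith
  have hh6' : μ * h ≤ 6 * (μ * X) + 10 := by
    have hm := mul_le_mul_of_nonneg_left hh6 hμ0.le
    have e : μ * (6 * X + 10) = 6 * (μ * X) + 10 * μ := by ring
    rw [e] at hm
    linarith
  have hXle := arith_core hε hε1 hR0 hη0.le hLc hl0 hX2' hQ1' hd2 h20 hlW hT2 hWle hh6'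
  -- `μ·X ≤ 3(1+ε)R + K₀` ⟹ `X ≤ (3/μ)(1+ε)R + K₀/μ`
  have hμne : μ ≠ 0 := hμ0.ne'
  have hXdiv : X ≤ 3 / μ * (1 + ε) * R + (5 * (ε / 6) + 120 * η) / μ :=
    calc X = μ⁻¹ * (μ * X) := by rw [← mul_assoc, inv_mul_cancel₀ hμne, one_mul]
      _ ≤ μ⁻¹ * (3 * (1 + ε) * R + (5 * (ε / 6) + 120 * η)) :=
          mul_le_mul_of_nonneg_left hXle (inv_pos.mpr hμ0).le
      _ = 3 / μ * (1 + ε) * R + (5 * (ε / 6) + 120 * η) / μ := by ring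
  rw [← hR]
  linarith

/-- **`c < C_ε·rad(abc)^{3/μ+ε}` for EVERY abc triple from the DILATED display at the rational points** (exponential form of
`log_le_of_dilatedDisplay_degOne` at `ε' = min(ε,1)·μ/3`). At `μ = 1`: abc-iut-S6's `abc_exp_three_of_thm110LegendreUpTo_one`. CONDITIONAL; nothing
asserted; no side taken. [cite: Mochizuki2012, IUTchIV Cor. 2.2–2.3 pp. 41–55] [claim: Mochizuki2012, status: disputed] -/
theorem abc_exp_of_dilatedDisplay_degOne {μ : ℝ} (hμ0 : 0 < μ) (hμ1 : μ ≤ 1)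
    (hdisp : ∀ η : ℝ, IsEtaPrm η → ∀ P : NFPoint, P ∈ UP → P.degree ≤ 1 → ∀ l : ℕ, l.Prime → 5 ≤ l →
      AdmitsCore P → CondP2 P l → CondP5 P l → CondP6 P l →
      1 / 6 * (μ * logQAvoid P {2, l}) ≤
        (1 + 20 * (dmod P : ℝ) / l) * (P.logDiff + logCondAvoid P {2, l})
          + 20 * (2 ^ 12 * 3 ^ 3 * 5 * (dmod P : ℝ) * l + η))
    {ε : ℝ} (hε : 0 < ε) :
    ∃ C : ℝ, 0 < C ∧ ∀ a b c : ℕ, IsABCTriple a b c →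
      (c : ℝ) < C * ((rad a b c : ℕ) : ℝ) ^ (3 / μ + ε) := by
  -- work with `ε' = min(ε,1)·μ/3`, so that `(3/μ)(1+ε') = 3/μ + min(ε,1)`
  set ε' : ℝ := min ε 1 * μ / 3 with hε'
  have hm0 : 0 < min ε 1 := lt_min hε one_pos
  have hε'0 : 0 < ε' := by rw [hε']; positivity
  have hε'1 : ε' ≤ 1 := by
    rw [hε']
    have : min ε 1 * μ ≤ 1 * 1 := mul_le_mul (min_le_right ε 1) hμ1 hμ0.le (by norm_num)
    linarith
  obtain ⟨C, hC⟩ := log_le_of_dilatedDisplay_degOne hμ0 hμ1 hdisp hε'0 hε'1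
  refine ⟨Real.exp C + 1, by positivity, fun a b c ht => ?_⟩
  have hlog := hC a b c ht
  have hcpos : 0 < c := by have := ht.2.2.1; have := ht.1; omega
  have hc0 : (0 : ℝ) < c := by exact_mod_cast hcpos
  have hrad : 0 < rad a b c := by rw [rad_def]; exact Nat.pos_of_ne_zero UniqueFactorizationMonoid.radical_ne_zero
  have hr0 : (0 : ℝ) < (rad a b c : ℝ) := by exact_mod_cast hrad
  have hr1 : (1 : ℝ) ≤ (rad a b c : ℝ) := by exact_mod_cast hrad
  have hR0 : 0 ≤ Real.log (rad a b c) := Real.log_nonneg hr1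
  -- `(3/μ)(1+ε')·log rad = (3/μ + min(ε,1))·log rad ≤ (3/μ+ε)·log rad`
  have h3 : 3 / μ * (1 + ε') * Real.log (rad a b c) ≤ (3 / μ + ε) * Real.log (rad a b c) := by
    apply mul_le_mul_of_nonneg_right _ hR0
    have hμne : μ ≠ 0 := hμ0.ne'
    have e : 3 / μ * (1 + ε') = 3 / μ + min ε 1 := by
      rw [hε']
      field_simp
    rw [e]
    have := min_le_left ε 1
    linarith
  have hle : Real.log c ≤ (3 / μ + ε) * Real.log (rad a b c) + C := by linarith
  have hexp : (c : ℝ) ≤ Real.exp C * (rad a b c : ℝ) ^ (3 / μ + ε) := by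
    have h1 : (c : ℝ) = Real.exp (Real.log c) := (Real.exp_log hc0).symm
    have h2 : ((rad a b c : ℕ) : ℝ) ^ (3 / μ + ε) = Real.exp ((3 / μ + ε) * Real.log (rad a b c)) := by
      rw [Real.rpow_def_of_pos hr0, mul_comm]
    rw [h1, h2, ← Real.exp_add]
    exact Real.exp_le_exp.mpr (by linarith)
  have hpow : 0 < (rad a b c : ℝ) ^ (3 / μ + ε) := Real.rpow_pos_of_pos hr0 _
  calc (c : ℝ) ≤ Real.exp C * (rad a b c : ℝ) ^ (3 / μ + ε) := hexp
    _ < (Real.exp C + 1) * (rad a b c : ℝ) ^ (3 / μ + ε) := by nlinarith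

end Summit.ABC.IUTFork.Repair.RH.OffSigma

end
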